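import Summits.AtomisticToContinuum.HydrodynamicLimit.Theorems.AntiMazurCoboundariesKineticWindowGronwallDensityOnlyWindowRenyi
import Summits.AtomisticToContinuum.HydrodynamicLimit.Theorems.AntiMazurCoboundariesKineticWindowGronwallWindowRenyiOfIncrementTightnessPrelim
import Summits.AtomisticToContinuum.HydrodynamicLimit.Theorems.AntiMazurCoboundariesKineticWindowGronwallPlusNode
import Literature.MathematicalPhysics.KineticTheory.HardSphereDisplacementPathLength
import Literature.MathematicalPhysics.KineticTheory.CollisionWindowBookkeeping
import Literature.Analysis.FluidPDE.CollisionalTransfer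
import Mathlib.MeasureTheory.Integral.MeanInequalities
import HarnessLib

/-!
# The energy increment from the frozen-coefficient transfer
# (stub `stub_energyIncrementOfFrozenTransfer`, line `board-node-dock`, crux `KineticWindowGronwall`, stmt-AtomisticToContinuum-9282)

Crux `Summit.AtomisticToContinuum.HydrodynamicLimit.Theses.AntiMazurCoboundaries.KineticWindowGronwall`; the wall of the line is the
LOCAL kinetic node, whose content (iii) is reduced (`WindowRenyiOfIncrementTightness`) to the exponential tightness of the kinetic-window
increments of `Σᵢ ‖vᵢ‖²/(2θ₀(xᵢ))`. THIS FILE: with `κ := θ₀⁻¹` the increment of `energyObservable κ` over `[0, s]` is `T + D`,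
`T = Σᵢ κ(xᵢ(s))(‖vᵢ(s)‖² − ‖vᵢ‖²)/2` the FROZEN-COEFFICIENT transfer (the hypothesis, at parameter `2c`) and
`D = Σᵢ (κ(xᵢ(s)) − κ(xᵢ))‖vᵢ‖²/2` the DISPLACEMENT part; by Cauchy–Schwarz it suffices that `∫ e^{2c|D|} dλ_N ≤ e^{ε(N+1)}`
eventually, uniformly in `0 ≤ s ≤ τ(N+1)^{-1/3}`, and this is STATIC: per particle, with the affine modulus `|κ x − κ y| ≤ δ + K·dist`,
the range `|κ x − κ y| ≤ Δ = (min θ₀)⁻¹`, a displacement threshold `η` and an energy cut-off `K'`,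
`|κ(xᵢ(s)) − κ(xᵢ)|‖vᵢ‖²/2 ≤ (δ + Kη)‖vᵢ‖²/2 + (ΔK'/(2η))·dist(xᵢ(s), xᵢ) + (Δ/2)(2‖vᵢ‖² − K')₊`; the total displacement is
`≤ s((N+1)/2 + E)` (path length), so `2c|D| ≤ cΔK's(N+1)/(2η) + Σᵢ (α‖vᵢ‖² + β(2‖vᵢ‖² − K')₊)`, `α = c(δ + Kη + ΔK's/(2η))`, `β = cΔ`,
a one-body functional of the time-0 velocities whose exponential moment factorises over the Gaussian fibres of `λ_N`
(`KineticWindowGronwallWindowRenyiOfIncrementTightnessPrelim.lintegral_prod_vel_le_pow`), each fibre giving `≤ exp(Cα + e^{β(2C − K')})`,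
`C = 1 + 2U² + 12θM`. Choices: `K'` (tail), then `δ`, `η = δ/(K+1)`, then `N₀` (`s → 0`); `c ≤ c₀ = θm/(64θM)`
keeps the Gaussian parameters below `1/(8θM)`. Folklore (Spohn 1991 Part I §2.3; GST 2013 §4.1). No Theses declaration is concluded.
-/

noncomputable section

namespace Summit.AtomisticToContinuum.HydrodynamicLimit.Theorems.KineticWindowGronwallEnergyIncrementOfFrozenTransfer

open _root_.MeasureTheory _root_.Set _root_.Filter
open scoped _root_.ENNReal
open Literature.Analysis.FluidPDE Literature.MathematicalPhysics.KineticTheory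

/-! ## §1 Statements (verbatim from the line's toolkit `Cruxes/KineticWindowGronwall/Lines/board_node_dock_toolkit.lean`) -/

/-- The hard-sphere flow of `N+1` spheres at reduced density `σ` on `𝕋³`. -/
abbrev TFlow (σ : ℝ) (N : ℕ) : Type :=
  HardSphereFlow (Torus.geometry (Fin 3)) (hsDiameter σ N) (N + 1)

/-- **Helper statement `EnergyIncrementOfFrozenTransfer`** (STATICS inside H_E): for continuous data with `a, θ₀ > 0` and a flow family
there is `c₀ > 0` (depending on the temperature range only) such that for every `0 < c ≤ c₀`: IF the FROZEN-COEFFICIENT collisional transfer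
`T(z, s) := Σᵢ (θ₀(xᵢ(s)))⁻¹ (‖vᵢ(s)‖² − ‖vᵢ(0)‖²)/2` (coefficients read at the END of the window; a sum over collisions of the exchanged
energy times the coefficient difference of the two partners, bounded by energies — blind to collision counts) has exponential moments
`≤ e^{ε(N+1)}` at parameter `2c`, eventually in `N`, uniformly over `0 ≤ s ≤ τ(N+1)^{-1/3}`, THEN so do the full increments of the weighted
kinetic energy `energyObservable θ₀⁻¹` at parameter `c` (hypothesis H_E of `WindowRenyiOfIncrementTightness`): the displacement part
`Σᵢ ((θ₀(xᵢ(s)))⁻¹ − (θ₀(xᵢ(0)))⁻¹)‖vᵢ(0)‖²/2` is exponentially negligible STATICALLY (affine modulus `δ + K·dist`; at most `(L/δ')·s((N+1)/2+E)`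
particles move farther than `δ'/K`; Gaussian high-energy content under the time-0 fibres). -/
def EnergyIncrementOfFrozenTransfer : Prop :=
  ∀ (σ : ℝ) (a θ₀ : T3 → ℝ) (u₀ : T3 → V3), Continuous a → Continuous θ₀ → Continuous u₀ →
    (∀ x, 0 < a x) → (∀ x, 0 < θ₀ x) → ∀ (Φ : (N : ℕ) → TFlow σ N),
    ∃ c₀ : ℝ, 0 < c₀ ∧ ∀ c : ℝ, 0 < c → c ≤ c₀ →
    (∀ τ ε : ℝ, 0 < τ → 0 < ε → ∃ N₀ : ℕ, ∀ N : ℕ, N₀ ≤ N → ∀ s : ℝ, 0 ≤ s →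
        s ≤ τ * ((N : ℝ) + 1) ^ (-(1 / 3 : ℝ)) →
        ∫⁻ z, ENNReal.ofReal (Real.exp (2 * c *
            |∑ i : Fin (N + 1), (θ₀ ((Φ N).flow s z i).1)⁻¹ * ((‖((Φ N).flow s z i).2‖ ^ 2 - ‖(z i).2‖ ^ 2) / 2)|))
          ∂(localGibbsLaw σ a u₀ θ₀ N (Φ N)) ≤ ENNReal.ofReal (Real.exp (ε * ((N : ℝ) + 1)))) →
    ∀ τ ε : ℝ, 0 < τ → 0 < ε → ∃ N₀ : ℕ, ∀ N : ℕ, N₀ ≤ N → ∀ s : ℝ, 0 ≤ s →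
        s ≤ τ * ((N : ℝ) + 1) ^ (-(1 / 3 : ℝ)) →
        ∫⁻ z, ENNReal.ofReal (Real.exp (c *
            |energyObservable (fun x => (θ₀ x)⁻¹) ((Φ N).flow s z) - energyObservable (fun x => (θ₀ x)⁻¹) z|))
          ∂(localGibbsLaw σ a u₀ θ₀ N (Φ N)) ≤ ENNReal.ofReal (Real.exp (ε * ((N : ℝ) + 1)))

/-! ## §2 Pointwise: the splitting and the displacement part on good orbits -/

section Pointwise

variable {σ : ℝ} {N : ℕ}

/-- **Increment = frozen transfer + displacement part**:
`Σᵢ κ(xᵢ')‖vᵢ'‖²/2 − Σᵢ κ(xᵢ)‖vᵢ‖²/2 = Σᵢ κ(xᵢ')(‖vᵢ'‖² − ‖vᵢ‖²)/2 + Σᵢ (κ(xᵢ') − κ(xᵢ))‖vᵢ‖²/2`. [folklore] -/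
theorem energyObservable_sub_eq (κ : T3 → ℝ) (w z : Config (N + 1) (Fin 3) T3) :
    energyObservable κ w - energyObservable κ z =
      ∑ i, κ (w i).1 * ((‖(w i).2‖ ^ 2 - ‖(z i).2‖ ^ 2) / 2) + ∑ i, (κ (w i).1 - κ (z i).1) * (‖(z i).2‖ ^ 2 / 2) := by
  simp only [energyObservable, ← Finset.sum_add_distrib, ← Finset.sum_sub_distrib]
  exact Finset.sum_congr rfl fun i _ => by ring

/-- **One particle**: `|k| ≤ δ + K d` (modulus against the displacement `d ≥ 0`), `|k| ≤ Δ` (range), `η > 0`, `K' ≥ 0`, `q ≥ 0` give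
`|k| q/2 ≤ (δ + Kη) q/2 + (ΔK'/(2η)) d + (Δ/2)(2q − K')₊` — `d < η`: small coefficient; else `d/η ≥ 1` pays `q ≤ K'`, the tail `q > K'`.
[folklore] -/
theorem coeff_mul_le {k d q δ K η Δ K' : ℝ} (hmod : |k| ≤ δ + K * d) (hkΔ : |k| ≤ Δ) (hδ : 0 ≤ δ) (hK : 0 ≤ K) (hη : 0 < η)
    (hΔ : 0 ≤ Δ) (hK' : 0 ≤ K') (hd : 0 ≤ d) (hq : 0 ≤ q) :
    |k| * (q / 2) ≤ (δ + K * η) * (q / 2) + Δ * K' / (2 * η) * d + Δ / 2 * max (2 * q - K') 0 := by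
  have ht1 : 0 ≤ (δ + K * η) * (q / 2) := by positivity
  have ht2 : 0 ≤ Δ * K' / (2 * η) * d := by positivity
  have ht3 : 0 ≤ Δ / 2 * max (2 * q - K') 0 := mul_nonneg (by positivity) (le_max_right _ _)
  rcases lt_or_ge d η with hdη | hdη
  · have h2 : |k| * (q / 2) ≤ (δ + K * η) * (q / 2) :=
      mul_le_mul_of_nonneg_right (hmod.trans (by nlinarith [mul_le_mul_of_nonneg_left hdη.le hK])) (by positivity)
    linarith
  · have h1 : |k| * (q / 2) ≤ Δ * (q / 2) := mul_le_mul_of_nonneg_right hkΔ (by positivity)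
    rcases le_or_gt q K' with hqK | hqK
    · have h6 : Δ * (K' / 2) * 1 ≤ Δ * (K' / 2) * (d / η) := mul_le_mul_of_nonneg_left ((one_le_div hη).2 hdη) (by positivity)
      have h7 : Δ * (K' / 2) * (d / η) = Δ * K' / (2 * η) * d := by ring
      linarith [mul_le_mul_of_nonneg_left hqK hΔ]
    · have h5 : Δ / 2 * q ≤ Δ / 2 * max (2 * q - K') 0 := mul_le_mul_of_nonneg_left (le_max_of_le_left (by linarith)) (by positivity)
      linarith

variable (Φ : TFlow σ N)

/-- **Total forward displacement against energy** on a good orbit, `0 ≤ s`: `Σᵢ dist(xᵢ(s), xᵢ(0)) ≤ s((N+1)/2 + E(z))` (path length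
`HardSphereFlow.euclidDist_flow_le_integral_norm_vel`, `‖v‖ ≤ ½ + ½‖v‖²`, energy conservation: `sum_integral_norm_vel_le`). [folklore] -/
theorem sum_euclidDist_flow_le {z : Config (N + 1) (Fin 3) T3} (hz : z ∈ Φ.good) {s : ℝ} (hs : 0 ≤ s) :
    ∑ i, Torus.euclidDist (Φ.flow s z i).1 (z i).1 ≤ s * (((N : ℝ) + 1) / 2 + configEnergy z) := by
  have h1 : ∀ i, Torus.euclidDist (Φ.flow s z i).1 (z i).1 ≤ ∫ u in (0 : ℝ)..s, ‖(Φ.flow u z i).2‖ := fun i => by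
    simpa only [Φ.flow_zero z hz] using Φ.euclidDist_flow_le_integral_norm_vel hz i hs
  calc ∑ i, Torus.euclidDist (Φ.flow s z i).1 (z i).1 ≤ ∑ i, ∫ u in (0 : ℝ)..s, ‖(Φ.flow u z i).2‖ := Finset.sum_le_sum fun i _ => h1 i
    _ ≤ (s - 0) * (((N + 1 : ℕ) : ℝ) / 2 + configEnergy z) := sum_integral_norm_vel_le Φ hz hs
    _ = s * (((N : ℝ) + 1) / 2 + configEnergy z) := by push_cast; ring

/-- **The displacement part on good orbits**: affine modulus `δ + K·dist` and range `Δ` of `κ`, threshold `η > 0`, cut-off `K' ≥ 0`: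
`|Σᵢ (κ(xᵢ(s)) − κ(xᵢ))‖vᵢ‖²/2| ≤ (δ + Kη)E(z) + (ΔK'/(2η))·s((N+1)/2 + E(z)) + (Δ/2)Σᵢ(2‖vᵢ‖² − K')₊` (`0 ≤ s`, `z` good). [folklore] -/
theorem abs_displacement_le {κ : T3 → ℝ} {δ K η Δ K' : ℝ} (hδ : 0 ≤ δ) (hK : 0 ≤ K) (hη : 0 < η) (hΔ : 0 ≤ Δ) (hK' : 0 ≤ K')
    (hmod : ∀ x y, |κ x - κ y| ≤ δ + K * Torus.euclidDist x y) (hκΔ : ∀ x y, |κ x - κ y| ≤ Δ)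
    {z : Config (N + 1) (Fin 3) T3} (hz : z ∈ Φ.good) {s : ℝ} (hs : 0 ≤ s) :
    |∑ i, (κ (Φ.flow s z i).1 - κ (z i).1) * (‖(z i).2‖ ^ 2 / 2)| ≤
      (δ + K * η) * configEnergy z + Δ * K' / (2 * η) * (s * (((N : ℝ) + 1) / 2 + configEnergy z)) +
        Δ / 2 * ∑ i, max (2 * ‖(z i).2‖ ^ 2 - K') 0 := by
  have hE : configEnergy z = ∑ i, ‖(z i).2‖ ^ 2 / 2 := by
    rw [configEnergy, Finset.mul_sum]
    exact Finset.sum_congr rfl fun i _ => by ring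
  calc |∑ i, (κ (Φ.flow s z i).1 - κ (z i).1) * (‖(z i).2‖ ^ 2 / 2)|
      ≤ ∑ i, |(κ (Φ.flow s z i).1 - κ (z i).1) * (‖(z i).2‖ ^ 2 / 2)| := Finset.abs_sum_le_sum_abs _ _
    _ ≤ ∑ i, ((δ + K * η) * (‖(z i).2‖ ^ 2 / 2) + Δ * K' / (2 * η) * Torus.euclidDist (Φ.flow s z i).1 (z i).1 +
          Δ / 2 * max (2 * ‖(z i).2‖ ^ 2 - K') 0) := by
        refine Finset.sum_le_sum fun i _ => ?_
        rw [abs_mul, abs_of_nonneg (by positivity : (0 : ℝ) ≤ ‖(z i).2‖ ^ 2 / 2)]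
        exact coeff_mul_le (hmod _ _) (hκΔ _ _) hδ hK hη hΔ hK' (by rw [Torus.euclidDist_eq]; exact norm_nonneg _) (sq_nonneg _)
    _ = (δ + K * η) * configEnergy z + Δ * K' / (2 * η) * ∑ i, Torus.euclidDist (Φ.flow s z i).1 (z i).1 +
          Δ / 2 * ∑ i, max (2 * ‖(z i).2‖ ^ 2 - K') 0 := by
        rw [Finset.sum_add_distrib, Finset.sum_add_distrib, ← Finset.mul_sum, ← Finset.mul_sum, ← Finset.mul_sum, hE]
    _ ≤ _ := by
        gcongr
        exact sum_euclidDist_flow_le Φ hz hs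

/-- The frozen transfer `z ↦ Σᵢ κ(xᵢ(s))(‖vᵢ(s)‖² − ‖vᵢ‖²)/2` and the displacement part `z ↦ Σᵢ (κ(xᵢ(s)) − κ(xᵢ))‖vᵢ‖²/2` are measurable
(continuous `κ`, measurable flow map). [folklore] -/
theorem measurable_transfer_displacement (s : ℝ) {κ : T3 → ℝ} (hκ : Continuous κ) :
    (Measurable fun z : Config (N + 1) (Fin 3) T3 => ∑ i, κ (Φ.flow s z i).1 * ((‖(Φ.flow s z i).2‖ ^ 2 - ‖(z i).2‖ ^ 2) / 2)) ∧
      Measurable fun z : Config (N + 1) (Fin 3) T3 => ∑ i, (κ (Φ.flow s z i).1 - κ (z i).1) * (‖(z i).2‖ ^ 2 / 2) := by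
  have h1 : ∀ i, Measurable fun z : Config (N + 1) (Fin 3) T3 => Φ.flow s z i :=
    fun i => (measurable_pi_apply i).comp (Φ.measurable_flow s)
  have h2 : ∀ i, Measurable fun z : Config (N + 1) (Fin 3) T3 => z i := fun i => measurable_pi_apply i
  exact ⟨Finset.measurable_sum _ fun i _ => (hκ.measurable.comp (h1 i).fst).mul
      ((((h1 i).snd.norm.pow_const 2).sub ((h2 i).snd.norm.pow_const 2)).div_const 2),
    Finset.measurable_sum _ fun i _ => ((hκ.measurable.comp (h1 i).fst).sub (hκ.measurable.comp (h2 i).fst)).mul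
      (((h2 i).snd.norm.pow_const 2).div_const 2)⟩

end Pointwise

/-! ## §3 Cauchy–Schwarz for two exponential factors -/

/-- **Cauchy–Schwarz**: `∫ e^{2c|T|} dμ ≤ e^A`, `∫ e^{2c|D|} dμ ≤ e^B` (`T, D` measurable, `c ≥ 0`) give `∫ e^{c|T + D|} dμ ≤ e^{(A+B)/2}`
(`|T + D| ≤ |T| + |D|`, Hölder with exponents `2, 2`). [folklore] -/
theorem lintegral_exp_abs_add_le {Ω : Type*} [MeasurableSpace Ω] (μ : Measure Ω) {T D : Ω → ℝ} (hT : Measurable T) (hD : Measurable D)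
    {c A B : ℝ} (hc : 0 ≤ c) (hA : ∫⁻ x, ENNReal.ofReal (Real.exp (2 * c * |T x|)) ∂μ ≤ ENNReal.ofReal (Real.exp A))
    (hB : ∫⁻ x, ENNReal.ofReal (Real.exp (2 * c * |D x|)) ∂μ ≤ ENNReal.ofReal (Real.exp B)) :
    ∫⁻ x, ENNReal.ofReal (Real.exp (c * |T x + D x|)) ∂μ ≤ ENNReal.ofReal (Real.exp ((A + B) / 2)) := by
  have hsq : ∀ t : ℝ, ENNReal.ofReal (Real.exp (c * |t|)) ^ (2 : ℝ) = ENNReal.ofReal (Real.exp (2 * c * |t|)) := fun t => by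
    rw [ENNReal.ofReal_rpow_of_nonneg (Real.exp_pos _).le zero_le_two, ← Real.exp_mul]
    congr 2
    ring
  have hcs := ENNReal.lintegral_mul_le_Lp_mul_Lq μ Real.HolderConjugate.two_two (hT.abs.const_mul c).exp.ennreal_ofReal.aemeasurable
    (hD.abs.const_mul c).exp.ennreal_ofReal.aemeasurable
  simp only [Pi.mul_apply, hsq] at hcs
  calc ∫⁻ x, ENNReal.ofReal (Real.exp (c * |T x + D x|)) ∂μ
      ≤ ∫⁻ x, ENNReal.ofReal (Real.exp (c * |T x|)) * ENNReal.ofReal (Real.exp (c * |D x|)) ∂μ := by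
        refine lintegral_mono fun x => ?_
        rw [← ENNReal.ofReal_mul (Real.exp_pos _).le, ← Real.exp_add, ← mul_add]
        exact ENNReal.ofReal_le_ofReal (Real.exp_le_exp.2 (mul_le_mul_of_nonneg_left (abs_add_le _ _) hc))
    _ ≤ _ := hcs
    _ ≤ ENNReal.ofReal (Real.exp A) ^ (1 / (2 : ℝ)) * ENNReal.ofReal (Real.exp B) ^ (1 / (2 : ℝ)) := by gcongr
    _ = ENNReal.ofReal (Real.exp ((A + B) / 2)) := by
        rw [ENNReal.ofReal_rpow_of_nonneg (Real.exp_pos _).le (by norm_num : (0 : ℝ) ≤ 1 / 2),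
          ENNReal.ofReal_rpow_of_nonneg (Real.exp_pos _).le (by norm_num : (0 : ℝ) ≤ 1 / 2), ← Real.exp_mul, ← Real.exp_mul,
          ← ENNReal.ofReal_mul (Real.exp_pos _).le, ← Real.exp_add]
        congr 2
        ring

/-! ## §4 Statics: the one-site Gaussian bound and the displacement moment -/

section Statics

variable {σ : ℝ} {a θ₀ : T3 → ℝ} {u₀ : T3 → V3}

/-- **One site**: `0 < θ ≤ θM`, `‖u‖ ≤ U`, `α, β ≥ 0`, `8θM(α + 2β) ≤ 1`, any `K'`: `∫ exp(α‖v‖² + β(2‖v‖² − K')₊) N(u, θ)(dv) ≤ exp(Cα + e^{β(2C − K')})`,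
`C = 1 + 2U² + 12θM` — pointwise `e^{αq + β(2q−K')₊} ≤ e^{α(1+q)} + e^{−βK'} e^{(α+2β)(1+q)}`, two Gaussian moments
(`KineticWindowGronwallWindowEnergyMoment.lintegral_exp_mul_one_add_sq_norm_gaussMeasure_le`), `1 + x ≤ eˣ`. [folklore] -/
theorem lintegral_onesite_le {θ θM U α β : ℝ} (K' : ℝ) (hθ : 0 < θ) (hθM : θ ≤ θM) {u : V3} (hu : ‖u‖ ≤ U) (hα : 0 ≤ α) (hβ : 0 ≤ β)
    (hαβ : 8 * θM * (α + 2 * β) ≤ 1) :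
    ∫⁻ v, ENNReal.ofReal (Real.exp (α * ‖v‖ ^ 2 + β * max (2 * ‖v‖ ^ 2 - K') 0)) ∂(gaussMeasure u θ) ≤
      ENNReal.ofReal (Real.exp ((1 + 2 * U ^ 2 + 12 * θM) * α + Real.exp (β * (2 * (1 + 2 * U ^ 2 + 12 * θM) - K')))) := by
  set C := 1 + 2 * U ^ 2 + 12 * θM with hC
  have h8 : α + 2 * β ≤ 1 / (8 * θM) := by
    rw [le_div_iff₀ (by linarith : 0 < 8 * θM)]
    linarith
  have hm1 : Measurable fun v : V3 => ENNReal.ofReal (Real.exp (α * (1 + ‖v‖ ^ 2))) :=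
    (Real.continuous_exp.comp (by fun_prop)).measurable.ennreal_ofReal
  have hm2 : Measurable fun v : V3 => ENNReal.ofReal (Real.exp ((α + 2 * β) * (1 + ‖v‖ ^ 2))) :=
    (Real.continuous_exp.comp (by fun_prop)).measurable.ennreal_ofReal
  have hpt : ∀ v : V3, ENNReal.ofReal (Real.exp (α * ‖v‖ ^ 2 + β * max (2 * ‖v‖ ^ 2 - K') 0)) ≤ ENNReal.ofReal (Real.exp (α * (1 + ‖v‖ ^ 2))) +
      ENNReal.ofReal (Real.exp (-(β * K'))) * ENNReal.ofReal (Real.exp ((α + 2 * β) * (1 + ‖v‖ ^ 2))) := by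
    intro v
    rw [← ENNReal.ofReal_mul (Real.exp_pos _).le, ← Real.exp_add, ← ENNReal.ofReal_add (Real.exp_pos _).le (Real.exp_pos _).le]
    refine ENNReal.ofReal_le_ofReal ?_
    have hq : 0 ≤ ‖v‖ ^ 2 := sq_nonneg _
    have e1 := Real.exp_pos (α * (1 + ‖v‖ ^ 2))
    have e2 := Real.exp_pos (-(β * K') + (α + 2 * β) * (1 + ‖v‖ ^ 2))
    rcases max_cases (2 * ‖v‖ ^ 2 - K') 0 with ⟨h, -⟩ | ⟨h, -⟩ <;> rw [h]
    · linarith [Real.exp_le_exp.2 (show α * ‖v‖ ^ 2 + β * (2 * ‖v‖ ^ 2 - K') ≤ -(β * K') + (α + 2 * β) * (1 + ‖v‖ ^ 2) by nlinarith)]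
    · linarith [Real.exp_le_exp.2 (show α * ‖v‖ ^ 2 + β * 0 ≤ α * (1 + ‖v‖ ^ 2) by nlinarith)]
  have hI1 := KineticWindowGronwallWindowEnergyMoment.lintegral_exp_mul_one_add_sq_norm_gaussMeasure_le hθ hθM hu hα (by linarith)
  have hI2 := KineticWindowGronwallWindowEnergyMoment.lintegral_exp_mul_one_add_sq_norm_gaussMeasure_le hθ hθM hu (by positivity) h8
  calc ∫⁻ v, ENNReal.ofReal (Real.exp (α * ‖v‖ ^ 2 + β * max (2 * ‖v‖ ^ 2 - K') 0)) ∂(gaussMeasure u θ)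
      ≤ ∫⁻ v, (ENNReal.ofReal (Real.exp (α * (1 + ‖v‖ ^ 2))) +
          ENNReal.ofReal (Real.exp (-(β * K'))) * ENNReal.ofReal (Real.exp ((α + 2 * β) * (1 + ‖v‖ ^ 2)))) ∂(gaussMeasure u θ) :=
        lintegral_mono hpt
    _ ≤ ENNReal.ofReal (Real.exp (C * α)) + ENNReal.ofReal (Real.exp (-(β * K'))) * ENNReal.ofReal (Real.exp (C * (α + 2 * β))) := by
        rw [lintegral_add_left hm1, lintegral_const_mul _ hm2]
        gcongr
    _ = ENNReal.ofReal (Real.exp (C * α) * (1 + Real.exp (β * (2 * C - K')))) := by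
        rw [← ENNReal.ofReal_mul (Real.exp_pos _).le, ← Real.exp_add, ← ENNReal.ofReal_add (Real.exp_pos _).le (Real.exp_pos _).le,
          show -(β * K') + C * (α + 2 * β) = C * α + β * (2 * C - K') by ring, Real.exp_add (C * α)]
        congr 1
        ring
    _ ≤ ENNReal.ofReal (Real.exp (C * α + Real.exp (β * (2 * C - K')))) := by
        refine ENNReal.ofReal_le_ofReal ?_
        rw [Real.exp_add (C * α)]
        gcongr
        linarith [Real.add_one_le_exp (Real.exp (β * (2 * C - K')))]

/-- **The exponential moment of the displacement part** (fixed `N`, `s`; modulus `δ + K·dist` and range `Δ` of `θ₀⁻¹`, threshold `η > 0`,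
cut-off `K' ≥ 0`, Gaussian constraint `8θM(α + 2β) ≤ 1` for `α = c(δ + Kη + ΔK's/(2η))`, `β = cΔ`):
`∫ e^{2c|D|} dλ_N ≤ exp((N+1)(cΔK's/(2η) + Cα + e^{β(2C − K')}))`, `C = 1 + 2U² + 12θM` (pointwise bound on the conull good set, fibre
factorisation `KineticWindowGronwallWindowRenyiOfIncrementTightnessPrelim.lintegral_prod_vel_le_pow`, one-site bound). [folklore] -/
theorem lintegral_exp_displacement_le (ha : Continuous a) (hθ : Continuous θ₀) (hu : Continuous u₀) (ha0 : ∀ x, 0 < a x)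
    (hθ0 : ∀ x, 0 < θ₀ x) {θM U : ℝ} (hθM : ∀ x, θ₀ x ≤ θM) (hUu : ∀ x, ‖u₀ x‖ ≤ U) {δ K η Δ K' c s : ℝ} (hδ : 0 ≤ δ) (hK : 0 ≤ K)
    (hη : 0 < η) (hΔ : 0 ≤ Δ) (hK' : 0 ≤ K') (hc : 0 ≤ c) (hs : 0 ≤ s) (hmod : ∀ x y, |(θ₀ x)⁻¹ - (θ₀ y)⁻¹| ≤ δ + K * Torus.euclidDist x y)
    (hκΔ : ∀ x y, |(θ₀ x)⁻¹ - (θ₀ y)⁻¹| ≤ Δ) (hG : 8 * θM * (c * (δ + K * η + Δ * K' * s / (2 * η)) + 2 * (c * Δ)) ≤ 1) (N : ℕ)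
    (Φ : TFlow σ N) :
    ∫⁻ z, ENNReal.ofReal (Real.exp (2 * c * |∑ i, ((θ₀ (Φ.flow s z i).1)⁻¹ - (θ₀ (z i).1)⁻¹) * (‖(z i).2‖ ^ 2 / 2)|))
        ∂(localGibbsLaw σ a u₀ θ₀ N Φ) ≤
      ENNReal.ofReal (Real.exp (((N : ℝ) + 1) * (c * Δ * K' * s / (2 * η) + (1 + 2 * U ^ 2 + 12 * θM) * (c * (δ + K * η + Δ * K' * s / (2 * η))) +
        Real.exp (c * Δ * (2 * (1 + 2 * U ^ 2 + 12 * θM) - K'))))) := by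
  set C := 1 + 2 * U ^ 2 + 12 * θM with hC
  set α : ℝ := c * (δ + K * η + Δ * K' * s / (2 * η)) with hα
  set β : ℝ := c * Δ with hβ
  have hα0 : 0 ≤ α := by positivity
  have hβ0 : 0 ≤ β := by positivity
  set g : V3 → ℝ≥0∞ := fun v => ENNReal.ofReal (Real.exp (α * ‖v‖ ^ 2 + β * max (2 * ‖v‖ ^ 2 - K') 0)) with hg
  have hq : Measurable fun v : V3 => ‖v‖ ^ 2 := measurable_norm.pow_const 2
  have hgm : Measurable g := ((hq.const_mul α).add ((((hq.const_mul 2).sub_const K').max measurable_const).const_mul β)).exp.ennreal_ofReal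
  set M : ℝ≥0∞ := ENNReal.ofReal (Real.exp (C * α + Real.exp (β * (2 * C - K')))) with hM
  have hfib : ∀ x : T3, ∫⁻ v, g v ∂gaussMeasure (u₀ x) (θ₀ x) ≤ M := fun x => lintegral_onesite_le K' (hθ0 x) (hθM x) (hUu x) hα0 hβ0 hG
  set A : ℝ := c * Δ * K' * s / (2 * η) * ((N : ℝ) + 1) with hA
  -- pointwise bound on the conull good set
  have hpt : ∀ᵐ z ∂(localGibbsLaw σ a u₀ θ₀ N Φ), ENNReal.ofReal (Real.exp (2 * c *
      |∑ i, ((θ₀ (Φ.flow s z i).1)⁻¹ - (θ₀ (z i).1)⁻¹) * (‖(z i).2‖ ^ 2 / 2)|)) ≤ ENNReal.ofReal (Real.exp A) * ∏ i, g (z i).2 := by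
    filter_upwards [KineticWindowGronwallQuadraticMoment.ae_mem_good_localGibbsLaw σ a u₀ θ₀ N Φ] with z hz
    have hD := abs_displacement_le Φ (κ := fun x => (θ₀ x)⁻¹) hδ hK hη hΔ hK' hmod hκΔ hz hs
    have h2 : 2 * c * |∑ i, ((θ₀ (Φ.flow s z i).1)⁻¹ - (θ₀ (z i).1)⁻¹) * (‖(z i).2‖ ^ 2 / 2)| ≤
        A + ∑ i, (α * ‖(z i).2‖ ^ 2 + β * max (2 * ‖(z i).2‖ ^ 2 - K') 0) :=
      calc 2 * c * |∑ i, ((θ₀ (Φ.flow s z i).1)⁻¹ - (θ₀ (z i).1)⁻¹) * (‖(z i).2‖ ^ 2 / 2)| ≤ _ := mul_le_mul_of_nonneg_left hD (by positivity)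
        _ = _ := by
            simp only [Finset.sum_add_distrib, ← Finset.mul_sum, configEnergy]
            ring
    calc ENNReal.ofReal (Real.exp (2 * c * |∑ i, ((θ₀ (Φ.flow s z i).1)⁻¹ - (θ₀ (z i).1)⁻¹) * (‖(z i).2‖ ^ 2 / 2)|))
        ≤ ENNReal.ofReal (Real.exp (A + ∑ i, (α * ‖(z i).2‖ ^ 2 + β * max (2 * ‖(z i).2‖ ^ 2 - K') 0))) := ENNReal.ofReal_le_ofReal (Real.exp_le_exp.2 h2)
      _ = ENNReal.ofReal (Real.exp A) * ∏ i, g (z i).2 := by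
          rw [Real.exp_add, ENNReal.ofReal_mul (Real.exp_pos _).le, Real.exp_sum, ENNReal.ofReal_prod_of_nonneg fun i _ => (Real.exp_pos _).le]
  calc ∫⁻ z, ENNReal.ofReal (Real.exp (2 * c * |∑ i, ((θ₀ (Φ.flow s z i).1)⁻¹ - (θ₀ (z i).1)⁻¹) * (‖(z i).2‖ ^ 2 / 2)|))
        ∂(localGibbsLaw σ a u₀ θ₀ N Φ)
      ≤ ∫⁻ z, ENNReal.ofReal (Real.exp A) * ∏ i, g (z i).2 ∂(localGibbsLaw σ a u₀ θ₀ N Φ) := lintegral_mono_ae hpt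
    _ = ENNReal.ofReal (Real.exp A) * ∫⁻ z, ∏ i, g (z i).2 ∂(localGibbsLaw σ a u₀ θ₀ N Φ) := lintegral_const_mul' _ _ ENNReal.ofReal_ne_top
    _ ≤ ENNReal.ofReal (Real.exp A) * M ^ (N + 1) := mul_le_mul' le_rfl
        (KineticWindowGronwallWindowRenyiOfIncrementTightnessPrelim.lintegral_prod_vel_le_pow ha hθ hu ha0 hθ0 σ N Φ hgm hfib ENNReal.ofReal_ne_top)
    _ = _ := by
        rw [hM, ← ENNReal.ofReal_pow (Real.exp_pos _).le, ← Real.exp_nat_mul, ← ENNReal.ofReal_mul (Real.exp_pos _).le, ← Real.exp_add]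
        congr 2
        push_cast
        ring

/-- **The displacement part is exponentially negligible, eventually**: for the range bound `Δ > 0` of `θ₀⁻¹` and `0 < c` with `64cΔθM ≤ 1`,
every `τ` and `ε > 0`: eventually in `N`, for all `0 ≤ s ≤ τ(N+1)^{-1/3}`, `∫ e^{2c|D|} dλ_N ≤ e^{ε(N+1)}` — choices: the cut-off `K'`
(tail rate `e^{cΔ(2C−K')} = e4`), the precision `δ = e4/(2Cc)` and threshold `η = δ/(K+1)`, then `N₀` (window length `→ 0`), `4e4 = min ε 1`. [folklore] -/
theorem displacement_moment_eventually (ha : Continuous a) (hθ : Continuous θ₀) (hu : Continuous u₀) (ha0 : ∀ x, 0 < a x)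
    (hθ0 : ∀ x, 0 < θ₀ x) {θM U : ℝ} (hθM : ∀ x, θ₀ x ≤ θM) (hUu : ∀ x, ‖u₀ x‖ ≤ U) {Δ : ℝ} (hΔ0 : 0 < Δ)
    (hκΔ : ∀ x y, |(θ₀ x)⁻¹ - (θ₀ y)⁻¹| ≤ Δ) (Φ : (N : ℕ) → TFlow σ N) {c : ℝ} (hc : 0 < c) (hcΔ : 64 * c * Δ * θM ≤ 1) (τ : ℝ) {ε : ℝ}
    (hε : 0 < ε) :
    ∃ N₀ : ℕ, ∀ N : ℕ, N₀ ≤ N → ∀ s : ℝ, 0 ≤ s → s ≤ τ * ((N : ℝ) + 1) ^ (-(1 / 3 : ℝ)) →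
      ∫⁻ z, ENNReal.ofReal (Real.exp (2 * c * |∑ i, ((θ₀ ((Φ N).flow s z i).1)⁻¹ - (θ₀ (z i).1)⁻¹) * (‖(z i).2‖ ^ 2 / 2)|))
        ∂(localGibbsLaw σ a u₀ θ₀ N (Φ N)) ≤ ENNReal.ofReal (Real.exp (ε * ((N : ℝ) + 1))) := by
  have hθMpos : 0 < θM := (hθ0 0).trans_le (hθM 0)
  set C : ℝ := 1 + 2 * U ^ 2 + 12 * θM with hC
  have hC12 : 12 * θM ≤ C := by rw [hC]; nlinarith [sq_nonneg U]
  have hC0 : 0 < C := by positivity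
  set e4 : ℝ := min ε 1 / 4 with he4
  have he4pos : 0 < e4 := by positivity
  have he4ε : 4 * e4 ≤ ε := by rw [he4]; linarith [min_le_left ε 1]
  have he41 : 4 * e4 ≤ 1 := by rw [he4]; linarith [min_le_right ε 1]
  -- (i) the energy cut-off `K'`: tail rate `e^{cΔ(2C − K')} = e4`
  set K' : ℝ := 2 * C - Real.log e4 / (c * Δ) with hK'def
  have hlog : Real.log e4 / (c * Δ) < 0 := div_neg_of_neg_of_pos (Real.log_neg he4pos (by linarith)) (by positivity)
  have hK'0 : 0 < K' := by rw [hK'def]; linarith [hθMpos]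
  have hK' : Real.exp (c * Δ * (2 * C - K')) ≤ e4 := by
    rw [hK'def, show c * Δ * (2 * C - (2 * C - Real.log e4 / (c * Δ))) = Real.log e4 by field_simp; ring, Real.exp_log he4pos]
  -- (ii) the modulus precision `δ` and the displacement threshold `η`
  set δ : ℝ := e4 / (2 * C * c) with hδ
  have hδpos : 0 < δ := by positivity
  have hκc : Continuous fun x => (θ₀ x)⁻¹ := hθ.inv₀ fun x => (hθ0 x).ne'
  obtain ⟨K, hK0, hmod⟩ := KineticWindowGronwallDensityOnlyWindowRenyi.exists_affine_modulus hκc hδpos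
  set η : ℝ := δ / (K + 1) with hη
  have hηpos : 0 < η := by positivity
  have hKη : K * η ≤ δ := by
    rw [hη, mul_div_assoc', div_le_iff₀ (by positivity)]
    nlinarith
  have hR1 : C * (c * (δ + K * η)) ≤ e4 := by
    calc C * (c * (δ + K * η)) ≤ C * (c * (2 * δ)) := by gcongr; linarith
      _ = e4 := by rw [hδ]; field_simp
  -- (iii) the window: `(1 + C)cΔK'/(2η) · s ≤ e4` eventually
  have hBpos : 0 < (1 + C) * c * Δ * K' / (2 * η) := by positivity
  have hwin : Tendsto (fun N : ℕ => τ * ((N : ℝ) + 1) ^ (-(1 / 3 : ℝ))) atTop (nhds 0) := by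
    simpa using ((tendsto_rpow_neg_atTop (by norm_num : (0 : ℝ) < 1 / 3)).comp
      (tendsto_atTop_add_const_right _ 1 tendsto_natCast_atTop_atTop)).const_mul τ
  obtain ⟨N₀, hN₀⟩ := eventually_atTop.1 (hwin.eventually (Iic_mem_nhds (show (0 : ℝ) < e4 / ((1 + C) * c * Δ * K' / (2 * η)) by positivity)))
  refine ⟨N₀, fun N hN s hs0 hs => ?_⟩
  have hsB : (1 + C) * c * Δ * K' / (2 * η) * s ≤ e4 := by
    have h1 : s ≤ e4 / ((1 + C) * c * Δ * K' / (2 * η)) := hs.trans (hN₀ N hN)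
    rwa [le_div_iff₀ hBpos, mul_comm] at h1
  -- the Gaussian constraint `8θM(α + 2β) ≤ 1` and the rate `≤ ε`
  have hp1 : 0 ≤ c * (δ + K * η) := by positivity
  have hp2 : 0 ≤ c * Δ * K' * s / (2 * η) := by positivity
  have e1 : 12 * θM * (c * (δ + K * η)) ≤ C * (c * (δ + K * η)) := mul_le_mul_of_nonneg_right hC12 hp1
  have e2 : 12 * θM * (c * Δ * K' * s / (2 * η)) ≤ (1 + C) * (c * Δ * K' * s / (2 * η)) := mul_le_mul_of_nonneg_right (by linarith) hp2
  have e3 : (1 + C) * (c * Δ * K' * s / (2 * η)) = (1 + C) * c * Δ * K' / (2 * η) * s := by ring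
  have hG : 8 * θM * (c * (δ + K * η + Δ * K' * s / (2 * η)) + 2 * (c * Δ)) ≤ 1 := by
    rw [show c * (δ + K * η + Δ * K' * s / (2 * η)) = c * (δ + K * η) + c * Δ * K' * s / (2 * η) by ring]
    nlinarith [hθMpos.le]
  refine (lintegral_exp_displacement_le ha hθ hu ha0 hθ0 hθM hUu hδpos.le hK0 hηpos hΔ0.le hK'0.le hc.le hs0 hmod hκΔ hG N (Φ N)).trans
    (ENNReal.ofReal_le_ofReal (Real.exp_le_exp.2 ?_))
  rw [← hC, mul_comm ε]
  refine mul_le_mul_of_nonneg_left ?_ (by positivity)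
  rw [show c * Δ * K' * s / (2 * η) + C * (c * (δ + K * η + Δ * K' * s / (2 * η))) =
    (1 + C) * c * Δ * K' / (2 * η) * s + C * (c * (δ + K * η)) by ring]
  linarith

end Statics

/-! ## §5 Assembly: the registered stub -/

/-- **`stub_energyIncrementOfFrozenTransfer`: the registered statement `EnergyIncrementOfFrozenTransfer` holds**, with `c₀ = θm/(64θM)`
(`θm ≤ θ₀ ≤ θM` the attained temperature range): increment `= T + D` (`energyObservable_sub_eq`), Cauchy–Schwarz (`lintegral_exp_abs_add_le`)
between the hypothesis (frozen transfer at parameter `2c`) and the static displacement bound (`displacement_moment_eventually`). [folklore] -/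
theorem stub_energyIncrementOfFrozenTransfer : EnergyIncrementOfFrozenTransfer := by
  intro σ a θ₀ u₀ ha hθ hu ha0 hθ0 Φ
  -- the attained temperature range, a drift bound, the range of `θ₀⁻¹`
  obtain ⟨θm, θM, ⟨xm, hxm⟩, hθm_le, hθM_ge⟩ := KineticWindowGronwallPlusNode.exists_bounds_T3 hθ
  have hθm : 0 < θm := hxm ▸ hθ0 xm
  have hθM : 0 < θM := (hθ0 xm).trans_le (hθM_ge xm)
  obtain ⟨-, U, -, -, hU_le⟩ := KineticWindowGronwallPlusNode.exists_bounds_T3 hu.norm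
  have hκΔ : ∀ x y, |(θ₀ x)⁻¹ - (θ₀ y)⁻¹| ≤ θm⁻¹ := by
    intro x y
    have h1 : 0 < (θ₀ x)⁻¹ := inv_pos.2 (hθ0 x)
    have h2 : 0 < (θ₀ y)⁻¹ := inv_pos.2 (hθ0 y)
    have h3 : (θ₀ x)⁻¹ ≤ θm⁻¹ := inv_anti₀ hθm (hθm_le x)
    have h4 : (θ₀ y)⁻¹ ≤ θm⁻¹ := inv_anti₀ hθm (hθm_le y)
    rw [abs_sub_le_iff]
    constructor <;> linarith
  refine ⟨θm / (64 * θM), by positivity, fun c hc hcc₀ hT τ ε hτ hε => ?_⟩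
  have hcΔ : 64 * c * θm⁻¹ * θM ≤ 1 := by
    calc 64 * c * θm⁻¹ * θM ≤ 64 * (θm / (64 * θM)) * θm⁻¹ * θM := by gcongr
      _ = 1 := by field_simp
  obtain ⟨N₁, hN₁⟩ := displacement_moment_eventually ha hθ hu ha0 hθ0 hθM_ge hU_le (inv_pos.2 hθm) hκΔ Φ hc hcΔ τ hε
  obtain ⟨N₂, hN₂⟩ := hT τ ε hτ hε
  refine ⟨max N₁ N₂, fun N hN s hs0 hs => ?_⟩
  have hκc : Continuous fun x => (θ₀ x)⁻¹ := hθ.inv₀ fun x => (hθ0 x).ne'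
  have hm := measurable_transfer_displacement (Φ N) s hκc
  have key := lintegral_exp_abs_add_le (localGibbsLaw σ a u₀ θ₀ N (Φ N)) hm.1 hm.2 hc.le (hN₂ N ((le_max_right _ _).trans hN) s hs0 hs)
    (hN₁ N ((le_max_left _ _).trans hN) s hs0 hs)
  refine (lintegral_congr fun z => by rw [energyObservable_sub_eq]).trans_le (key.trans_eq ?_)
  congr 2
  ring

end Summit.AtomisticToContinuum.HydrodynamicLimit.Theorems.KineticWindowGronwallEnergyIncrementOfFrozenTransfer

end
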